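import Summits.CriticalPhenomena.PercolationContinuityZ3.Theorems.SahiMasterFamilyFCombShiftDet

/-!
# THEOREM R***: unimodularity of the face-domination kernel on up-sets of `{0<1<2}^J`
# (LEMMA J** of the one-shared-coordinate programme — support file)

Support file (prover seat `prim-bnk-2`, gen 31; `--supports stmt-CriticalPhenomena-4575`).  Memo:
`run/shared/lean/prim/prim-l12/FROM-prim-bnk-2-g31-COMPRESSION-THEOREM.md` §2bis.

A *face* is a pair `(w, t)` of disjoint finsets (`w` = coordinates in state `1`, `t` = state `2`, the rest of the ground list
`l` = state `0`).  The **face-domination kernel** `faceIncl l ℱ ℋ` has entry `1` at `((w,t),(w',t'))` iff `w ⊆ t'` and every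
coordinate of `l` outside `w ∪ t` lies in `w'` (state `1 ↦ 2`, state `0 ↦ 1`, state `2 ↦` anything); it is the `J`-fold tensor power of
the `3 × 3` kernel `m(0,b) = [b=1], m(1,b) = [b=2], m(2,b) = 1`, restricted to `ℱ × ℋ`.

**THEOREM R*** (`isUnit_det_faceIncl`).**  If `ℱ` is closed under the moves `0 → 1` (`(w,t) ↦ (insert a w, t)`) and `1 → 2`
(`(w,t) ↦ (w.erase a, insert a t)`) for the coordinates `a ∈ l` (an up-set of `{0<1<2}^l`), then `det (faceIncl l ℱ ℱ) = ±1`.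
Proof (memo §2bis): split the first coordinate `c`; the sections `A₀ ⊆ A₁ ⊆ A₂` are again such families, the matrix is the block matrix
`[[0,K₀₁,0],[0,0,K₁₂],[K₂₀,K₂₁,K₂₂]]` (`K_ab = faceIncl l' A_a A_b`), and two Schur complements (`det_fromBlocks₂₂`) together with
`K_ab ⅟K_bb K_bc = K_ac` for `A_a ⊆ A_b` reduce `det` to `± det K₂₂ · det K₁₁ · det K₀₀`, units by induction.

Use: with `T_w = U_l(ΔC ∩ 2^{J∖w})` the canonical LEMMA-I** up-sets, the leaver family `{(w,t) : t ∈ T_w}` of LEMMA J** is such a `ℱ`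
and `faceIncl` is its leaver-to-slot domination matrix, so a non-zero Leibniz term is the routing required by LEMMA J** (memo §2bis;
the assembly is left to the companion work).  One plumbing definition (`faceIncl`); no `sorry`; standard axioms.
-/

namespace Summit.CriticalPhenomena.PercolationContinuityZ3.Theorems

namespace SahiFComb.Shift

open Finset Matrix

variable {α : Type*} [DecidableEq α]

/-- The face-domination kernel between two families of faces `(w,t)` over the coordinate list `l`:
entry `1` at `(f,g)` iff `f.w ⊆ g.t` and every coordinate of `l` outside `f.w ∪ f.t` lies in `g.w`. [this work] -/
def faceIncl (l : List α) (ℱ ℋ : Finset (Finset α × Finset α)) : Matrix ℱ ℋ ℤ :=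
  Matrix.of fun f g =>
    if (f : Finset α × Finset α).1 ⊆ (g : Finset α × Finset α).2 ∧
        ∀ a ∈ l, a ∉ (f : Finset α × Finset α).1 → a ∉ (f : Finset α × Finset α).2 → a ∈ (g : Finset α × Finset α).1
    then 1 else 0

/-- Entries of the face-domination kernel. [this work] -/
theorem faceIncl_apply (l : List α) (ℱ ℋ : Finset (Finset α × Finset α)) (f : ℱ) (g : ℋ) :
    faceIncl l ℱ ℋ f g =
      if (f : Finset α × Finset α).1 ⊆ (g : Finset α × Finset α).2 ∧
          ∀ a ∈ l, a ∉ (f : Finset α × Finset α).1 → a ∉ (f : Finset α × Finset α).2 → a ∈ (g : Finset α × Finset α).1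
      then 1 else 0 := rfl

/-- Restricting the rows of the kernel to a subfamily. [this work] -/
theorem faceIncl_submatrix {l : List α} {𝒜 ℬ 𝒞 : Finset (Finset α × Finset α)} (h : 𝒜 ⊆ ℬ) :
    faceIncl l 𝒜 𝒞 = (faceIncl l ℬ 𝒞).submatrix (fun a => ⟨a.1, h a.2⟩) id := by
  ext a g; rfl

/-- The selection identity: for `𝒜 ⊆ ℬ` and `K_ℬℬ` invertible, `K_𝒜ℬ ⅟K_ℬℬ K_ℬ𝒞 = K_𝒜𝒞`. [this work] -/
theorem faceIncl_mul_invOf_mul {l : List α} {𝒜 ℬ 𝒞 : Finset (Finset α × Finset α)} (h : 𝒜 ⊆ ℬ)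
    [Invertible (faceIncl l ℬ ℬ)] :
    faceIncl l 𝒜 ℬ * ⅟(faceIncl l ℬ ℬ) * faceIncl l ℬ 𝒞 = faceIncl l 𝒜 𝒞 := by
  set ι : ↥𝒜 → ↥ℬ := fun a => ⟨a.1, h a.2⟩ with hι
  have h1 : faceIncl l 𝒜 ℬ * ⅟(faceIncl l ℬ ℬ) = (1 : Matrix ℬ ℬ ℤ).submatrix ι id := by
    calc faceIncl l 𝒜 ℬ * ⅟(faceIncl l ℬ ℬ)
        = (faceIncl l ℬ ℬ).submatrix ι id * (⅟(faceIncl l ℬ ℬ)).submatrix id id := by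
          rw [faceIncl_submatrix h, Matrix.submatrix_id_id]
      _ = (faceIncl l ℬ ℬ * ⅟(faceIncl l ℬ ℬ)).submatrix ι id :=
          (Matrix.submatrix_mul _ _ ι id id Function.bijective_id).symm
      _ = (1 : Matrix ℬ ℬ ℤ).submatrix ι id := by rw [mul_invOf_self]
  calc faceIncl l 𝒜 ℬ * ⅟(faceIncl l ℬ ℬ) * faceIncl l ℬ 𝒞
      = (1 : Matrix ℬ ℬ ℤ).submatrix ι id * (faceIncl l ℬ 𝒞).submatrix id id := by
        rw [h1, Matrix.submatrix_id_id]
    _ = ((1 : Matrix ℬ ℬ ℤ) * faceIncl l ℬ 𝒞).submatrix ι id :=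
        (Matrix.submatrix_mul _ _ ι id id Function.bijective_id).symm
    _ = faceIncl l 𝒜 𝒞 := by rw [Matrix.one_mul, ← faceIncl_submatrix h]

/-- **THEOREM R*** (prim-bnk-2 g31, memo §2bis).**  For every family `ℱ` of faces `(w,t)` (disjoint finsets supported on the
duplicate-free coordinate list `l`) which is closed under the moves `(w,t) ↦ (insert a w, t)` (`a ∈ l` fresh) and
`(w,t) ↦ (w.erase a, insert a t)` (`a ∈ w`) — an up-set of `{0<1<2}^l` — the face-domination kernel `faceIncl l ℱ ℱ` has a unit
determinant. [this work] -/
theorem isUnit_det_faceIncl :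
    ∀ (l : List α), l.Nodup → ∀ (ℱ : Finset (Finset α × Finset α)),
      (∀ p ∈ ℱ, Disjoint p.1 p.2) →
      (∀ p ∈ ℱ, ∀ a, a ∈ p.1 ∨ a ∈ p.2 → a ∈ l) →
      (∀ p ∈ ℱ, ∀ a ∈ l, a ∉ p.1 → a ∉ p.2 → (insert a p.1, p.2) ∈ ℱ) →
      (∀ p ∈ ℱ, ∀ a ∈ p.1, (p.1.erase a, insert a p.2) ∈ ℱ) →
      IsUnit (faceIncl l ℱ ℱ).det
  | [], _, ℱ, hd, hs, _, _ => by
    -- every face is `(∅, ∅)`: the matrix is `0 × 0` or the `1 × 1` matrix `(1)`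
    have hall : ∀ p ∈ ℱ, p = (∅, ∅) := by
      intro p hp
      have h1 : p.1 = ∅ := eq_empty_of_forall_notMem fun a ha => by simpa using hs p hp a (Or.inl ha)
      have h2 : p.2 = ∅ := eq_empty_of_forall_notMem fun a ha => by simpa using hs p hp a (Or.inr ha)
      exact Prod.ext h1 h2
    have hM : faceIncl [] ℱ ℱ = 1 := by
      ext f g
      have hfg : f = g := Subtype.ext ((hall f.1 f.2).trans (hall g.1 g.2).symm)
      subst hfg
      rw [faceIncl_apply, Matrix.one_apply_eq, if_pos]
      refine ⟨?_, fun a ha => absurd ha List.not_mem_nil⟩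
      simp [show (f : Finset α × Finset α) = (∅, ∅) from hall f.1 f.2]
    rw [hM, Matrix.det_one]; exact isUnit_one
  | c :: l, hl, ℱ, hd, hs, h01, h12 => by
    obtain ⟨hcl, hl'⟩ : c ∉ l ∧ l.Nodup := List.nodup_cons.1 hl
    -- the three sections along `c`
    set A₀ : Finset (Finset α × Finset α) := ℱ.filter (fun p => c ∉ p.1 ∧ c ∉ p.2) with hA₀
    set A₁ : Finset (Finset α × Finset α) := (ℱ.filter (fun p => c ∈ p.1)).image (fun p => (p.1.erase c, p.2)) with hA₁
    set A₂ : Finset (Finset α × Finset α) := (ℱ.filter (fun p => c ∈ p.2)).image (fun p => (p.1, p.2.erase c)) with hA₂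
    letI dA₀ : DecidableEq ↥A₀ := Subtype.instDecidableEq
    letI dA₁ : DecidableEq ↥A₁ := Subtype.instDecidableEq
    letI dA₂ : DecidableEq ↥A₂ := Subtype.instDecidableEq
    have mem0 : ∀ q, q ∈ A₀ ↔ q ∈ ℱ ∧ c ∉ q.1 ∧ c ∉ q.2 := fun q => by rw [hA₀, mem_filter]
    have mem1 : ∀ q : Finset α × Finset α, q ∈ A₁ ↔ c ∉ q.1 ∧ c ∉ q.2 ∧ (insert c q.1, q.2) ∈ ℱ := by
      intro q
      rw [hA₁, mem_image]
      constructor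
      · rintro ⟨p, hp, rfl⟩
        rw [mem_filter] at hp
        refine ⟨notMem_erase c p.1, ?_, ?_⟩
        · exact fun h => (disjoint_left.1 (hd p hp.1)) hp.2 h
        · rw [insert_erase hp.2]; exact hp.1
      · rintro ⟨h1, -, h3⟩
        exact ⟨(insert c q.1, q.2), mem_filter.2 ⟨h3, mem_insert_self c q.1⟩, by rw [erase_insert h1]⟩
    have mem2 : ∀ q : Finset α × Finset α, q ∈ A₂ ↔ c ∉ q.1 ∧ c ∉ q.2 ∧ (q.1, insert c q.2) ∈ ℱ := by
      intro q
      rw [hA₂, mem_image]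
      constructor
      · rintro ⟨p, hp, rfl⟩
        rw [mem_filter] at hp
        refine ⟨?_, notMem_erase c p.2, ?_⟩
        · exact fun h => (disjoint_left.1 (hd p hp.1)) h hp.2
        · rw [insert_erase hp.2]; exact hp.1
      · rintro ⟨-, h2, h3⟩
        exact ⟨(q.1, insert c q.2), mem_filter.2 ⟨h3, mem_insert_self c q.2⟩, by rw [erase_insert h2]⟩
    -- nestedness of the sections
    have hA₀₁ : A₀ ⊆ A₁ := by
      intro q hq
      rw [mem0] at hq
      rw [mem1]
      exact ⟨hq.2.1, hq.2.2, h01 q hq.1 c List.mem_cons_self hq.2.1 hq.2.2⟩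
    have hA₁₂ : A₁ ⊆ A₂ := by
      intro q hq
      rw [mem1] at hq
      rw [mem2]
      refine ⟨hq.1, hq.2.1, ?_⟩
      have := h12 _ hq.2.2 c (mem_insert_self c q.1)
      rwa [erase_insert hq.1] at this
    -- the sections satisfy the hypotheses for `l`
    have secHyp : ∀ (A : Finset (Finset α × Finset α)),
        (∀ q : Finset α × Finset α, q ∈ A → c ∉ q.1 ∧ c ∉ q.2) →
        (∀ q : Finset α × Finset α, q ∈ A → ∃ w t, (w, t) ∈ ℱ ∧ q.1 ⊆ w ∧ q.2 ⊆ t ∧ w ⊆ insert c q.1 ∧ t ⊆ insert c q.2) →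
        (∀ q ∈ A, Disjoint q.1 q.2) ∧ (∀ q ∈ A, ∀ a, a ∈ q.1 ∨ a ∈ q.2 → a ∈ l) := by
      intro A hc hlift
      constructor
      · intro q hq
        obtain ⟨w, t, hwt, h1, h2, -, -⟩ := hlift q hq
        exact (hd _ hwt).mono h1 h2
      · intro q hq a ha
        obtain ⟨w, t, hwt, h1, h2, -, -⟩ := hlift q hq
        have hal : a ∈ c :: l := hs _ hwt a (ha.imp (fun h => h1 h) (fun h => h2 h))
        rcases List.mem_cons.1 hal with rfl | h
        · exact absurd ha (not_or.2 (hc q hq))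
        · exact h
    have hyp0 := secHyp A₀ (fun q hq => ((mem0 q).1 hq).2)
      (fun q hq => ⟨q.1, q.2, ((mem0 q).1 hq).1, Subset.refl _, Subset.refl _, subset_insert _ _, subset_insert _ _⟩)
    have hyp1 := secHyp A₁ (fun q hq => ⟨((mem1 q).1 hq).1, ((mem1 q).1 hq).2.1⟩)
      (fun q hq => ⟨insert c q.1, q.2, ((mem1 q).1 hq).2.2, subset_insert _ _, Subset.refl _, Subset.refl _, subset_insert _ _⟩)
    have hyp2 := secHyp A₂ (fun q hq => ⟨((mem2 q).1 hq).1, ((mem2 q).1 hq).2.1⟩)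
      (fun q hq => ⟨q.1, insert c q.2, ((mem2 q).1 hq).2.2, Subset.refl _, subset_insert _ _, subset_insert _ _, Subset.refl _⟩)
    have h01_0 : ∀ q ∈ A₀, ∀ a ∈ l, a ∉ q.1 → a ∉ q.2 → (insert a q.1, q.2) ∈ A₀ := by
      intro q hq a ha h1 h2
      have hq' := (mem0 q).1 hq
      have hac : a ≠ c := fun h => hcl (h ▸ ha)
      rw [mem0]
      exact ⟨h01 q hq'.1 a (List.mem_cons_of_mem _ ha) h1 h2, by
        rw [mem_insert, not_or]; exact ⟨hac.symm, hq'.2.1⟩, hq'.2.2⟩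
    have h12_0 : ∀ q ∈ A₀, ∀ a ∈ q.1, (q.1.erase a, insert a q.2) ∈ A₀ := by
      intro q hq a ha
      have hq' := (mem0 q).1 hq
      have hac : a ≠ c := fun h => hq'.2.1 (h ▸ ha)
      rw [mem0]
      exact ⟨h12 q hq'.1 a ha, fun h => hq'.2.1 (mem_of_mem_erase h), by
        rw [mem_insert, not_or]; exact ⟨hac.symm, hq'.2.2⟩⟩
    have h01_1 : ∀ q ∈ A₁, ∀ a ∈ l, a ∉ q.1 → a ∉ q.2 → (insert a q.1, q.2) ∈ A₁ := by
      intro q hq a ha h1 h2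
      have hq' := (mem1 q).1 hq
      have hac : a ≠ c := fun h => hcl (h ▸ ha)
      rw [mem1]
      refine ⟨by rw [mem_insert, not_or]; exact ⟨hac.symm, hq'.1⟩, hq'.2.1, ?_⟩
      have := h01 _ hq'.2.2 a (List.mem_cons_of_mem _ ha)
        (by rw [mem_insert, not_or]; exact ⟨hac, h1⟩) h2
      rwa [Finset.insert_comm] at this
    have h12_1 : ∀ q ∈ A₁, ∀ a ∈ q.1, (q.1.erase a, insert a q.2) ∈ A₁ := by
      intro q hq a ha
      have hq' := (mem1 q).1 hq
      have hac : a ≠ c := fun h => hq'.1 (h ▸ ha)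
      rw [mem1]
      refine ⟨fun h => hq'.1 (mem_of_mem_erase h), by rw [mem_insert, not_or]; exact ⟨hac.symm, hq'.2.1⟩, ?_⟩
      have := h12 _ hq'.2.2 a (mem_insert_of_mem ha)
      rwa [erase_insert_of_ne hac.symm] at this
    have h01_2 : ∀ q ∈ A₂, ∀ a ∈ l, a ∉ q.1 → a ∉ q.2 → (insert a q.1, q.2) ∈ A₂ := by
      intro q hq a ha h1 h2
      have hq' := (mem2 q).1 hq
      have hac : a ≠ c := fun h => hcl (h ▸ ha)
      rw [mem2]
      refine ⟨by rw [mem_insert, not_or]; exact ⟨hac.symm, hq'.1⟩, hq'.2.1, ?_⟩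
      exact h01 _ hq'.2.2 a (List.mem_cons_of_mem _ ha) h1 (by rw [mem_insert, not_or]; exact ⟨hac, h2⟩)
    have h12_2 : ∀ q ∈ A₂, ∀ a ∈ q.1, (q.1.erase a, insert a q.2) ∈ A₂ := by
      intro q hq a ha
      have hq' := (mem2 q).1 hq
      have hac : a ≠ c := fun h => hq'.1 (h ▸ ha)
      rw [mem2]
      refine ⟨fun h => hq'.1 (mem_of_mem_erase h), by rw [mem_insert, not_or]; exact ⟨hac.symm, hq'.2.1⟩, ?_⟩
      have := h12 _ hq'.2.2 a ha
      rwa [Finset.insert_comm] at this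
    -- induction hypotheses
    have ih0 : IsUnit (faceIncl l A₀ A₀).det := isUnit_det_faceIncl l hl' A₀ hyp0.1 hyp0.2 h01_0 h12_0
    have ih1 : IsUnit (faceIncl l A₁ A₁).det := isUnit_det_faceIncl l hl' A₁ hyp1.1 hyp1.2 h01_1 h12_1
    have ih2 : IsUnit (faceIncl l A₂ A₂).det := isUnit_det_faceIncl l hl' A₂ hyp2.1 hyp2.2 h01_2 h12_2
    letI : Invertible (faceIncl l A₂ A₂) := Matrix.invertibleOfIsUnitDet _ ih2
    letI : Invertible (faceIncl l A₁ A₁) := Matrix.invertibleOfIsUnitDet _ ih1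
    -- the reindexing `ℱ ≃ (A₀ ⊕ A₁) ⊕ A₂`
    have hcases : ∀ p ∈ ℱ, (c ∉ p.1 ∧ c ∉ p.2) ∨ c ∈ p.1 ∨ c ∈ p.2 := by
      intro p _; by_cases h1 : c ∈ p.1; exact Or.inr (Or.inl h1); by_cases h2 : c ∈ p.2; exact Or.inr (Or.inr h2)
      exact Or.inl ⟨h1, h2⟩
    let toP : (↥A₀ ⊕ ↥A₁) ⊕ ↥A₂ → ↥ℱ := fun x => match x with
      | Sum.inl (Sum.inl q) => ⟨q.1, ((mem0 q.1).1 q.2).1⟩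
      | Sum.inl (Sum.inr q) => ⟨(insert c q.1.1, q.1.2), ((mem1 q.1).1 q.2).2.2⟩
      | Sum.inr q => ⟨(q.1.1, insert c q.1.2), ((mem2 q.1).1 q.2).2.2⟩
    have toP_inj : Function.Injective toP := by
      rintro ((q | q) | q) ((q' | q') | q') h <;> simp only [toP, Subtype.mk.injEq] at h
      · exact congrArg _ (congrArg _ (Subtype.ext h))
      · exfalso; have := ((mem0 q.1).1 q.2).2.1; rw [h] at this; exact this (mem_insert_self _ _)
      · exfalso; have := ((mem0 q.1).1 q.2).2.2; rw [h] at this; exact this (mem_insert_self _ _)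
      · exfalso; have := ((mem0 q'.1).1 q'.2).2.1; rw [← h] at this; exact this (mem_insert_self _ _)
      · have hh := Prod.mk.inj h
        have h1 : q.1.1 = q'.1.1 := by
          rw [← erase_insert ((mem1 q.1).1 q.2).1, ← erase_insert ((mem1 q'.1).1 q'.2).1, hh.1]
        exact congrArg _ (congrArg _ (Subtype.ext (Prod.ext h1 hh.2)))
      · exfalso; have := ((mem2 q'.1).1 q'.2).1; rw [← (Prod.mk.inj h).1] at this; exact this (mem_insert_self _ _)
      · exfalso; have := ((mem0 q'.1).1 q'.2).2.2; rw [← h] at this; exact this (mem_insert_self _ _)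
      · exfalso; have := ((mem2 q.1).1 q.2).1; rw [(Prod.mk.inj h).1] at this; exact this (mem_insert_self _ _)
      · have hh := Prod.mk.inj h
        have h2 : q.1.2 = q'.1.2 := by
          rw [← erase_insert ((mem2 q.1).1 q.2).2.1, ← erase_insert ((mem2 q'.1).1 q'.2).2.1, hh.2]
        exact congrArg _ (Subtype.ext (Prod.ext hh.1 h2))
    have toP_surj : Function.Surjective toP := by
      intro p
      rcases hcases p.1 p.2 with h | h | h
      · exact ⟨Sum.inl (Sum.inl ⟨p.1, (mem0 _).2 ⟨p.2, h⟩⟩), rfl⟩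
      · refine ⟨Sum.inl (Sum.inr ⟨(p.1.1.erase c, p.1.2), (mem1 _).2 ⟨notMem_erase _ _, ?_, ?_⟩⟩), ?_⟩
        · exact fun h' => (disjoint_left.1 (hd _ p.2)) h h'
        · rw [insert_erase h]; exact p.2
        · apply Subtype.ext; show (insert c (p.1.1.erase c), p.1.2) = p.1; rw [insert_erase h]
      · refine ⟨Sum.inr ⟨(p.1.1, p.1.2.erase c), (mem2 _).2 ⟨?_, notMem_erase _ _, ?_⟩⟩, ?_⟩
        · exact fun h' => (disjoint_left.1 (hd _ p.2)) h' h
        · rw [insert_erase h]; exact p.2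
        · apply Subtype.ext; show (p.1.1, insert c (p.1.2.erase c)) = p.1; rw [insert_erase h]
    let e : (↥A₀ ⊕ ↥A₁) ⊕ ↥A₂ ≃ ↥ℱ := Equiv.ofBijective toP ⟨toP_inj, toP_surj⟩
    have e_ll : ∀ q : ↥A₀, ((e (Sum.inl (Sum.inl q)) : ↥ℱ) : Finset α × Finset α) = q.1 := fun q => rfl
    have e_lr : ∀ q : ↥A₁, ((e (Sum.inl (Sum.inr q)) : ↥ℱ) : Finset α × Finset α) = (insert c q.1.1, q.1.2) :=
      fun q => rfl
    have e_r : ∀ q : ↥A₂, ((e (Sum.inr q) : ↥ℱ) : Finset α × Finset α) = (q.1.1, insert c q.1.2) := fun q => rfl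
    -- the blocks
    let P : Matrix (↥A₀ ⊕ ↥A₁) (↥A₀ ⊕ ↥A₁) ℤ := Matrix.fromBlocks 0 (faceIncl l A₀ A₁) 0 0
    let Q : Matrix (↥A₀ ⊕ ↥A₁) ↥A₂ ℤ :=
      Matrix.of fun i j => Sum.elim (fun _ => (0 : ℤ)) (fun i₁ => faceIncl l A₁ A₂ i₁ j) i
    let R : Matrix ↥A₂ (↥A₀ ⊕ ↥A₁) ℤ :=
      Matrix.of fun i j => Sum.elim (fun j₀ => faceIncl l A₂ A₀ i j₀) (fun j₁ => faceIncl l A₂ A₁ i j₁) j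
    have hl_ne : ∀ x ∈ l, x ≠ c := fun x hx h => hcl (h ▸ hx)
    have hM : (faceIncl (c :: l) ℱ ℱ).submatrix e e = Matrix.fromBlocks P Q R (faceIncl l A₂ A₂) := by
      ext x y
      rcases x with ((q | q) | q) <;> rcases y with ((q' | q') | q')
      all_goals
        simp only [submatrix_apply, Matrix.fromBlocks_apply₁₁, Matrix.fromBlocks_apply₁₂, Matrix.fromBlocks_apply₂₁,
          Matrix.fromBlocks_apply₂₂, P, Q, R, Matrix.of_apply, Sum.elim_inl, Sum.elim_inr, Matrix.zero_apply,
          faceIncl_apply, e_ll, e_lr, e_r, List.forall_mem_cons]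
      · -- (0,0): zero (the fresh coordinate `c` is in state 0 in `f` but not in state 1 in `g`)
        rw [if_neg]
        rintro ⟨-, h, -⟩
        exact ((mem0 _).1 q'.2).2.1 (h ((mem0 _).1 q.2).2.1 ((mem0 _).1 q.2).2.2)
      · -- (0,1)
        refine if_congr ⟨?_, ?_⟩ rfl rfl
        · rintro ⟨h1, -, h3⟩
          exact ⟨h1, fun a ha ha1 ha2 => (mem_insert.1 (h3 a ha ha1 ha2)).resolve_left (hl_ne a ha)⟩
        · rintro ⟨h1, h3⟩
          exact ⟨h1, fun _ _ => mem_insert_self _ _, fun a ha ha1 ha2 => mem_insert_of_mem (h3 a ha ha1 ha2)⟩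
      · -- (0,2): zero
        rw [if_neg]
        rintro ⟨-, h, -⟩
        exact ((mem2 _).1 q'.2).1 (h ((mem0 _).1 q.2).2.1 ((mem0 _).1 q.2).2.2)
      · -- (1,0): zero (`c ∈ f.1` but `c ∉ g.2`)
        rw [if_neg]
        rintro ⟨h, -, -⟩
        exact ((mem0 _).1 q'.2).2.2 (h (mem_insert_self _ _))
      · -- (1,1): zero
        rw [if_neg]
        rintro ⟨h, -, -⟩
        exact ((mem1 _).1 q'.2).2.1 (h (mem_insert_self _ _))
      · -- (1,2)
        refine if_congr ⟨?_, ?_⟩ rfl rfl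
        · rintro ⟨h1, -, h3⟩
          refine ⟨fun x hx => ?_, fun a ha ha1 ha2 => h3 a ha ?_ ha2⟩
          · exact (mem_insert.1 (h1 (mem_insert_of_mem hx))).resolve_left (fun h => ((mem1 _).1 q.2).1 (h ▸ hx))
          · rw [mem_insert, not_or]; exact ⟨hl_ne a ha, ha1⟩
        · rintro ⟨h1, h3⟩
          refine ⟨insert_subset_insert c h1, fun h => absurd (mem_insert_self c _) h, fun a ha ha1 ha2 => h3 a ha ?_ ha2⟩
          exact fun h => ha1 (mem_insert_of_mem h)
      · -- (2,0)
        refine if_congr ⟨?_, ?_⟩ rfl rfl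
        · rintro ⟨h1, -, h3⟩
          refine ⟨h1, fun a ha ha1 ha2 => h3 a ha ha1 ?_⟩
          rw [mem_insert, not_or]; exact ⟨hl_ne a ha, ha2⟩
        · rintro ⟨h1, h3⟩
          exact ⟨h1, fun _ h => absurd (mem_insert_self c _) h, fun a ha ha1 ha2 =>
            h3 a ha ha1 (fun h => ha2 (mem_insert_of_mem h))⟩
      · -- (2,1)
        refine if_congr ⟨?_, ?_⟩ rfl rfl
        · rintro ⟨h1, -, h3⟩
          refine ⟨h1, fun a ha ha1 ha2 => ?_⟩
          have := h3 a ha ha1 (by rw [mem_insert, not_or]; exact ⟨hl_ne a ha, ha2⟩)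
          exact (mem_insert.1 this).resolve_left (hl_ne a ha)
        · rintro ⟨h1, h3⟩
          exact ⟨h1, fun _ h => absurd (mem_insert_self c _) h, fun a ha ha1 ha2 =>
            mem_insert_of_mem (h3 a ha ha1 (fun h => ha2 (mem_insert_of_mem h)))⟩
      · -- (2,2)
        refine if_congr ⟨?_, ?_⟩ rfl rfl
        · rintro ⟨h1, -, h3⟩
          refine ⟨fun x hx => ?_, fun a ha ha1 ha2 => h3 a ha ha1 ?_⟩
          · exact (mem_insert.1 (h1 hx)).resolve_left (fun h => ((mem2 _).1 q.2).1 (h ▸ hx))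
          · rw [mem_insert, not_or]; exact ⟨hl_ne a ha, ha2⟩
        · rintro ⟨h1, h3⟩
          exact ⟨h1.trans (subset_insert _ _), fun _ h => absurd (mem_insert_self c _) h, fun a ha ha1 ha2 =>
            h3 a ha ha1 (fun h => ha2 (mem_insert_of_mem h))⟩
    -- first Schur complement
    have hQSR : Q * ⅟(faceIncl l A₂ A₂) * R =
        Matrix.fromBlocks 0 0 (faceIncl l A₁ A₀) (faceIncl l A₁ A₁) := by
      have h1 : ∀ (B : Finset (Finset α × Finset α)),
          faceIncl l A₁ A₂ * ⅟(faceIncl l A₂ A₂) * faceIncl l A₂ B = faceIncl l A₁ B :=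
        fun B => faceIncl_mul_invOf_mul hA₁₂
      ext x y
      rcases x with (q | q) <;> rcases y with (q' | q')
      · simp [Q, R, Matrix.mul_apply]
      · simp [Q, R, Matrix.mul_apply]
      · have := congrFun (congrFun (h1 A₀) q) q'
        simp only [Matrix.mul_apply, Q, R, Matrix.of_apply, Sum.elim_inr, Sum.elim_inl,
          Matrix.fromBlocks_apply₂₁] at this ⊢
        exact this
      · have := congrFun (congrFun (h1 A₁) q) q'
        simp only [Matrix.mul_apply, Q, R, Matrix.of_apply, Sum.elim_inr, Matrix.fromBlocks_apply₂₂] at this ⊢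
        exact this
    have hSchur1 : P - Q * ⅟(faceIncl l A₂ A₂) * R = Matrix.fromBlocks (1 : Matrix ↥A₀ ↥A₀ ℤ) 0 0 (-1 : Matrix ↥A₁ ↥A₁ ℤ) *
        Matrix.fromBlocks 0 (faceIncl l A₀ A₁) (faceIncl l A₁ A₀) (faceIncl l A₁ A₁) := by
      rw [hQSR, Matrix.fromBlocks_multiply]
      ext (i | i) (j | j) <;> simp [P]
    -- second Schur complement
    have hSchur2 : (Matrix.fromBlocks 0 (faceIncl l A₀ A₁) (faceIncl l A₁ A₀) (faceIncl l A₁ A₁)).det =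
        (faceIncl l A₁ A₁).det * (-(faceIncl l A₀ A₀)).det := by
      rw [Matrix.det_fromBlocks₂₂, faceIncl_mul_invOf_mul hA₀₁, zero_sub]
    have hdetD : (Matrix.fromBlocks (1 : Matrix ↥A₀ ↥A₀ ℤ) 0 0 (-1 : Matrix ↥A₁ ↥A₁ ℤ)).det = (-1 : Matrix ↥A₁ ↥A₁ ℤ).det := by
      rw [Matrix.det_fromBlocks_zero₂₁, Matrix.det_one, one_mul]
    have hn0 : IsUnit (-(faceIncl l A₀ A₀)).det := by
      rw [Matrix.det_neg]; exact (isUnit_one.neg.pow _).mul ih0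
    have hn1 : IsUnit (-1 : Matrix ↥A₁ ↥A₁ ℤ).det := by
      rw [Matrix.det_neg, Matrix.det_one, mul_one]; exact isUnit_one.neg.pow _
    have hdet : (faceIncl (c :: l) ℱ ℱ).det = (faceIncl l A₂ A₂).det *
        ((Matrix.fromBlocks (1 : Matrix ↥A₀ ↥A₀ ℤ) 0 0 (-1 : Matrix ↥A₁ ↥A₁ ℤ)).det *
          ((faceIncl l A₁ A₁).det * (-(faceIncl l A₀ A₀)).det)) := by
      rw [← Matrix.det_submatrix_equiv_self e, hM, Matrix.det_fromBlocks₂₂, hSchur1, Matrix.det_mul, hSchur2]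
    rw [hdet, hdetD]
    exact ih2.mul (hn1.mul (ih1.mul hn0))

end SahiFComb.Shift

end Summit.CriticalPhenomena.PercolationContinuityZ3.Theorems
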